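import Summits.AtomisticToContinuum.FouriersLaw.Theorems.JunctionLocalityNonBallisticLightConeAssemblyPart2b
import Summits.AtomisticToContinuum.FouriersLaw.Theorems.JunctionLocalityNonBallisticLightConeAssemblyPart2c
import Summits.AtomisticToContinuum.FouriersLaw.Theorems.BondHeatUncertaintySubdiffusiveBondHeatGibbsMomentumFourthMoment
import Literature.MathematicalPhysics.KineticTheory.LangevinChainExpMartingale

/-!
# `NonBallistic` / light cone, assembly part 2d: the measure-theoretic terms of the single-flip estimate

Helper (`--supports stmt-AtomisticToContinuum-9127`) for stub `stub_lightConeWindow` (LC) of line `contact-current-forgetting`.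
Inputs of the single-flip estimate (part 2e), all for `π = μ_T ⊗ W` (Gibbs start, Brownian pair):

* `integral_momentum_four_le` — `∫ p_i⁴ dμ_T ≤ 3T²` at every site;
* `lintegral_weight_le` — the weight term `∫⁻ (d p_{i₀}⁴/2 + d (1+|p_k(Φ_s)|+|p_{k1}(Φ_s)|)⁴/2) dπ ≤ d (195T² + 32)`
  (stationarity on the Wiener space, part 2b);
* `lintegral_current_four_le` — `∫⁻ (j_k(Φ_s)²)² dπ ≤ C₄` from the Gibbs start and from the flipped Gibbs start
  (stationarity + flip invariance);
* `measure_bad_le` — the bad event `{H > KN} ∪ E ∪ Θ⁻¹E` has measure `≤ b₁ + 2b₂` (`Θ × id` preserves `π`);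
* `lintegral_indicator_sq_le_sqrt` — Hölder on the bad event: `∫⁻ 1_B f² ≤ √(C₄ b)`.
-/

noncomputable section

namespace Summit.AtomisticToContinuum.FouriersLaw.Theorems.NonBallistic

open MeasureTheory ProbabilityTheory Set Filter Topology
open scoped NNReal ENNReal
open Literature.MathematicalPhysics.KineticTheory.HeatConduction
open Literature.Probability.Process
open Summit.AtomisticToContinuum.FouriersLaw.Theorems.SubdiffusiveBondHeat

namespace FSAssembly

/-- Fourth Gibbs moment of any momentum: `p_i⁴ ∈ L¹(μ_T)` and `∫ p_i⁴ dμ_T ≤ 3T²` (Gaussian marginal; the proof of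
`stub_gibbsMomentumFourthMoment` verbatim for a general site). -/
theorem integral_momentum_four_le {ω₂ lam β : ℝ} (hω : 0 < ω₂) (hl : 0 ≤ lam) (hβ : 0 ≤ β) (γ : ℝ) (N : ℕ)
    {T : ℝ} (hT : 0 < T) (i : Fin N) :
    Integrable (fun z : PhaseSpace N => (z.2 i) ^ 4) ((pinnedChain ω₂ lam β γ).gibbsMeasure N T) ∧
      ∫ z, (z.2 i) ^ 4 ∂((pinnedChain ω₂ lam β γ).gibbsMeasure N T) ≤ 3 * T ^ 2 := by
  refine ⟨(pinnedChain ω₂ lam β γ).integrable_gibbsMeasure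
    (pinnedChain_integrable_momentum_pow_mul_gibbsDensity hω hl hβ γ N hT i le_rfl), ?_⟩
  rw [(pinnedChain ω₂ lam β γ).integral_gibbsMeasure]
  have h4 := pinnedChain_integral_momentum_pow_add_two hω hl hβ γ N hT i (k := 2) le_rfl
  have h2 := pinnedChain_integral_momentum_pow_add_two hω hl hβ γ N hT i (k := 0) (Nat.zero_le _)
  have hZ : 0 < ∫ x, (pinnedChain ω₂ lam β γ).gibbsDensity N T x :=
    integral_exp_pos (pinnedChain_integrable_gibbsDensity hω hl hβ γ N hT)
  have h0 : ∫ x, x.2 i ^ 0 * (pinnedChain ω₂ lam β γ).gibbsDensity N T x =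
      ∫ x, (pinnedChain ω₂ lam β γ).gibbsDensity N T x := by
    simp
  simp only [Nat.reduceAdd, Nat.cast_ofNat, Nat.cast_zero, zero_add, mul_one] at h4 h2
  rw [h0] at h2
  rw [h4, h2]
  have e : (∫ x, (pinnedChain ω₂ lam β γ).gibbsDensity N T x)⁻¹ *
      (T * (2 + 1) * (T * ∫ x, (pinnedChain ω₂ lam β γ).gibbsDensity N T x)) = 3 * T ^ 2 := by
    field_simp
    ring
  rw [e]

/-- `(1 + |a| + |b|)⁴ ≤ 64(1 + a⁴ + b⁴)` (two uses of `(u + v)⁴ ≤ 8(u⁴ + v⁴)`, cf.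
`Literature.Geometry.MetricEmbeddings.add_pow_four_le`). -/
theorem one_add_abs_add_abs_pow_four_le (a b : ℝ) : (1 + |a| + |b|) ^ 4 ≤ 64 * (1 + a ^ 4 + b ^ 4) := by
  have h8 : ∀ u v : ℝ, (u + v) ^ 4 ≤ 8 * (u ^ 4 + v ^ 4) := fun u v => by
    nlinarith [sq_nonneg (u - v), sq_nonneg (u + v), sq_nonneg (u ^ 2 - v ^ 2), sq_nonneg (u ^ 2 + v ^ 2),
      mul_nonneg (sq_nonneg (u - v)) (sq_nonneg (u + v))]
  have h1 := h8 (1 + |a|) |b|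
  have h2 := h8 1 |a|
  have ha : |a| ^ 4 = a ^ 4 := by rw [show (4:ℕ) = 2 * 2 by rfl, pow_mul, sq_abs, ← pow_mul]
  have hb : |b| ^ 4 = b ^ 4 := by rw [show (4:ℕ) = 2 * 2 by rfl, pow_mul, sq_abs, ← pow_mul]
  nlinarith [pow_nonneg (abs_nonneg a) 4, pow_nonneg (abs_nonneg b) 4]

/-- Hölder on a bad event of small probability: `∫⁻ 1_B · f² ≤ √(C₄ b)` when `∫⁻ (f²)² ≤ C₄` and `π(B) ≤ b`. -/
theorem lintegral_indicator_sq_le_sqrt {α : Type*} [MeasurableSpace α] (π : Measure α) {f : α → ℝ}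
    (hf : Measurable f) {B : Set α} (hB : MeasurableSet B) {C₄ b : ℝ} (hC₄ : 0 ≤ C₄) (hb : 0 ≤ b)
    (h4 : ∫⁻ a, ENNReal.ofReal (f a ^ 2) ^ 2 ∂π ≤ ENNReal.ofReal C₄) (hπB : π B ≤ ENNReal.ofReal b) :
    ∫⁻ a, B.indicator (fun _ => (1 : ℝ≥0∞)) a * ENNReal.ofReal (f a ^ 2) ∂π ≤
      ENNReal.ofReal (Real.sqrt (C₄ * b)) := by
  have hH := lintegral_indicator_mul_le_sqrt π (ENNReal.measurable_ofReal.comp (hf.pow_const 2)) hB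
  refine hH.trans ?_
  calc (∫⁻ a, ENNReal.ofReal (f a ^ 2) ^ 2 ∂π) ^ (1 / 2 : ℝ) * π B ^ (1 / 2 : ℝ)
      ≤ ENNReal.ofReal C₄ ^ (1 / 2 : ℝ) * ENNReal.ofReal b ^ (1 / 2 : ℝ) :=
        mul_le_mul' (ENNReal.rpow_le_rpow h4 (by norm_num)) (ENNReal.rpow_le_rpow hπB (by norm_num))
    _ = ENNReal.ofReal (Real.sqrt (C₄ * b)) := by
        rw [ENNReal.ofReal_rpow_of_nonneg hC₄ (by norm_num), ENNReal.ofReal_rpow_of_nonneg hb (by norm_num),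
          ← ENNReal.ofReal_mul (by positivity), Real.sqrt_eq_rpow, Real.mul_rpow hC₄ hb]

/-- The bad event `{H(x) > KN} ∪ E ∪ Θ_{i₀}⁻¹E` has `μ_T ⊗ W`-measure at most `b₁ + 2b₂` (the flip `Θ_{i₀} × id`
preserves `μ_T ⊗ W`). -/
theorem measure_bad_le (P : OscillatorChain) (N : ℕ) (T : ℝ) [IsProbabilityMeasure (P.gibbsMeasure N T)]
    (i₀ : Fin N) {B₁ : Set (PhaseSpace N)} (hB₁m : MeasurableSet B₁) {E : Set (PhaseSpace N × WienerPair)}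
    (hEm : MeasurableSet E) {b₁ b₂ : ℝ} (hb₁ : 0 ≤ b₁) (hb₂ : 0 ≤ b₂)
    (hB₁ : P.gibbsMeasure N T B₁ ≤ ENNReal.ofReal b₁)
    (hEπ : ((P.gibbsMeasure N T).prod wienerPair) E ≤ ENNReal.ofReal b₂) :
    ((P.gibbsMeasure N T).prod wienerPair)
        ((Prod.fst ⁻¹' B₁ ∪ E) ∪ (fun q : PhaseSpace N × WienerPair => (momentumFlip i₀ q.1, q.2)) ⁻¹' E) ≤
      ENNReal.ofReal (b₁ + 2 * b₂) := by
  set μ := P.gibbsMeasure N T with hμ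
  set π : Measure (PhaseSpace N × WienerPair) := μ.prod wienerPair with hπ
  have h1 : π (Prod.fst ⁻¹' B₁) = μ B₁ := by
    rw [← Measure.map_apply measurable_fst hB₁m, hπ, Measure.map_fst_prod, measure_univ, one_smul]
  have hmp : MeasurePreserving (Prod.map (momentumFlip i₀) id) π π :=
    (P.measurePreserving_momentumFlip_gibbsMeasure N T i₀).prod (MeasurePreserving.id wienerPair)
  have hΘeq : (fun q : PhaseSpace N × WienerPair => (momentumFlip i₀ q.1, q.2)) ⁻¹' E =
      (Prod.map (momentumFlip i₀) id) ⁻¹' E := by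
    ext ⟨x, ω⟩
    simp only [Set.mem_preimage, Prod.map_apply, id_eq]
  have h3 : π ((fun q : PhaseSpace N × WienerPair => (momentumFlip i₀ q.1, q.2)) ⁻¹' E) = π E := by
    rw [hΘeq]
    exact hmp.measure_preimage hEm.nullMeasurableSet
  calc π ((Prod.fst ⁻¹' B₁ ∪ E) ∪ (fun q : PhaseSpace N × WienerPair => (momentumFlip i₀ q.1, q.2)) ⁻¹' E)
      ≤ π (Prod.fst ⁻¹' B₁ ∪ E) + π ((fun q : PhaseSpace N × WienerPair => (momentumFlip i₀ q.1, q.2)) ⁻¹' E) :=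
        measure_union_le _ _
    _ ≤ (π (Prod.fst ⁻¹' B₁) + π E) + π ((fun q : PhaseSpace N × WienerPair => (momentumFlip i₀ q.1, q.2)) ⁻¹' E) :=
        add_le_add (measure_union_le _ _) le_rfl
    _ = μ B₁ + π E + π E := by rw [h1, h3]
    _ ≤ ENNReal.ofReal b₁ + ENNReal.ofReal b₂ + ENNReal.ofReal b₂ := add_le_add (add_le_add hB₁ hEπ) hEπ
    _ = ENNReal.ofReal (b₁ + 2 * b₂) := by
        rw [← ENNReal.ofReal_add hb₁ hb₂, ← ENNReal.ofReal_add (by positivity) hb₂]; ring_nf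

variable {ω₂ lam β γ : ℝ} (hω : 0 < ω₂) (hl : 0 < lam) (hβ : 0 < β) (hγ : 0 < γ) {N : ℕ} {T : ℝ} (hT : 0 < T)

include hω hl hβ hγ hT in
/-- The weight term: `∫⁻ (d·p_{i₀}⁴/2 + d·(1+|p_k(Φ_s)|+|p_{k1}(Φ_s)|)⁴/2) d(μ_T ⊗ W) ≤ d·(195T² + 32)` (stationarity on the
Wiener space + fourth Gibbs moments of the momenta). -/
theorem lintegral_weight_le (hN : 0 < N) (i₀ k k1 : Fin N) {d : ℝ} (hd0 : 0 ≤ d) (s : ℝ≥0) :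
    ∫⁻ q, (ENNReal.ofReal (d * ((q.1.2 i₀) ^ 4 / 2)) +
        ENNReal.ofReal (d * ((1 + |((pinnedChain ω₂ lam β γ).solMap N T T s q.1 (pairPath q.2)).2 k| +
          |((pinnedChain ω₂ lam β γ).solMap N T T s q.1 (pairPath q.2)).2 k1|) ^ 4 / 2)))
        ∂(((pinnedChain ω₂ lam β γ).gibbsMeasure N T).prod wienerPair) ≤
      ENNReal.ofReal (d * (195 * T ^ 2 + 32)) := by
  set P := pinnedChain ω₂ lam β γ with hP
  set μ := P.gibbsMeasure N T with hμ
  haveI hμP : IsProbabilityMeasure μ := pinnedChain_isProbabilityMeasure_gibbsMeasure hω hl.le hβ.le γ N hT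
  set π : Measure (PhaseSpace N × WienerPair) := μ.prod wienerPair with hπ
  have hzm : Measurable fun q : PhaseSpace N × WienerPair => P.solMap N T T s q.1 (pairPath q.2) :=
    pinnedChain_measurable_solMap_pairPath hω hl.le hβ.le hγ.le N T T s
  set g₂ : PhaseSpace N → ℝ := fun z => (1 + |z.2 k| + |z.2 k1|) ^ 4 / 2 with hg₂
  have hg₂m : Measurable g₂ := by
    have h1 : Measurable fun z : PhaseSpace N => z.2 k := (measurable_pi_apply k).comp measurable_snd
    have h2 : Measurable fun z : PhaseSpace N => z.2 k1 := (measurable_pi_apply k1).comp measurable_snd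
    exact (((measurable_const.add h1.abs).add h2.abs).pow_const 4).div_const 2
  set g₁ : PhaseSpace N → ℝ := fun x => (x.2 i₀) ^ 4 / 2 with hg₁
  have hg₁m : Measurable g₁ := (((measurable_pi_apply i₀).comp measurable_snd).pow_const 4).div_const 2
  have hg₂zm : Measurable fun q : PhaseSpace N × WienerPair => g₂ (P.solMap N T T s q.1 (pairPath q.2)) := by
    have h := hg₂m.comp hzm
    exact h
  have hiter : ∀ {G : PhaseSpace N × WienerPair → ℝ≥0∞}, Measurable G →
      ∫⁻ x, ∫⁻ ω, G (x, ω) ∂wienerPair ∂μ = ∫⁻ q, G q ∂π := by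
    intro G hG
    exact (lintegral_prod G hG.aemeasurable).symm
  have hmom4 : ∀ i : Fin N, Integrable (fun z : PhaseSpace N => (z.2 i) ^ 4) μ ∧ ∫ z, (z.2 i) ^ 4 ∂μ ≤ 3 * T ^ 2 :=
    fun i => integral_momentum_four_le hω hl.le hβ.le γ N hT i
  have hA1 : ∫⁻ q, ENNReal.ofReal (d * g₁ q.1) ∂π = ENNReal.ofReal (d * ∫ x, g₁ x ∂μ) := by
    have hm : Measurable fun q : PhaseSpace N × WienerPair => ENNReal.ofReal (d * g₁ q.1) :=
      ENNReal.measurable_ofReal.comp (measurable_const.mul (hg₁m.comp measurable_fst))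
    have e : ∀ x, ∫⁻ _ω, ENNReal.ofReal (d * g₁ x) ∂wienerPair = ENNReal.ofReal (d * g₁ x) := by
      intro x; rw [lintegral_const, measure_univ, mul_one]
    have hi : Integrable (fun x => d * g₁ x) μ := ((hmom4 i₀).1.div_const 2).const_mul d
    have hnn : 0 ≤ᵐ[μ] fun x => d * g₁ x := ae_of_all _ fun x => mul_nonneg hd0 (by positivity)
    calc ∫⁻ q, ENNReal.ofReal (d * g₁ q.1) ∂π = ∫⁻ x, ∫⁻ _ω, ENNReal.ofReal (d * g₁ x) ∂wienerPair ∂μ :=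
          (hiter (G := fun q => ENNReal.ofReal (d * g₁ q.1)) hm).symm
      _ = ∫⁻ x, ENNReal.ofReal (d * g₁ x) ∂μ := lintegral_congr e
      _ = ENNReal.ofReal (∫ x, d * g₁ x ∂μ) := (ofReal_integral_eq_lintegral_ofReal hi hnn).symm
      _ = ENNReal.ofReal (d * ∫ x, g₁ x ∂μ) := by rw [integral_const_mul]
  have hg₂int : Integrable g₂ μ := by
    have hb : Integrable (fun z : PhaseSpace N => 32 * (1 + (z.2 k) ^ 4 + (z.2 k1) ^ 4)) μ :=
      (((integrable_const 1).add (hmom4 k).1).add (hmom4 k1).1).const_mul 32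
    refine hb.mono' hg₂m.aestronglyMeasurable (ae_of_all _ fun z => ?_)
    simp only [hg₂, Real.norm_eq_abs]
    rw [abs_of_nonneg (by positivity)]
    have := one_add_abs_add_abs_pow_four_le (z.2 k) (z.2 k1)
    linarith
  have hA2 : ∫⁻ q, ENNReal.ofReal (d * g₂ (P.solMap N T T s q.1 (pairPath q.2))) ∂π =
      ENNReal.ofReal (d * ∫ z, g₂ z ∂μ) := by
    have hm : Measurable fun q : PhaseSpace N × WienerPair => ENNReal.ofReal (d * g₂ (P.solMap N T T s q.1 (pairPath q.2))) :=
      ENNReal.measurable_ofReal.comp (measurable_const.mul hg₂zm)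
    have hstat := lintegral_lintegral_solMap_gibbs hω hl.le hβ.le hγ.le hN hT
      (g := fun z => ENNReal.ofReal (d * g₂ z)) (ENNReal.measurable_ofReal.comp (measurable_const.mul hg₂m)) s
    have hi : Integrable (fun z => d * g₂ z) μ := hg₂int.const_mul d
    have hnn : 0 ≤ᵐ[μ] fun z => d * g₂ z := ae_of_all _ fun z => mul_nonneg hd0 (by positivity)
    calc ∫⁻ q, ENNReal.ofReal (d * g₂ (P.solMap N T T s q.1 (pairPath q.2))) ∂π
        = ∫⁻ x, ∫⁻ ω, ENNReal.ofReal (d * g₂ (P.solMap N T T s x (pairPath ω))) ∂wienerPair ∂μ :=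
          (hiter (G := fun q => ENNReal.ofReal (d * g₂ (P.solMap N T T s q.1 (pairPath q.2)))) hm).symm
      _ = ∫⁻ z, ENNReal.ofReal (d * g₂ z) ∂μ := hstat
      _ = ENNReal.ofReal (∫ z, d * g₂ z ∂μ) := (ofReal_integral_eq_lintegral_ofReal hi hnn).symm
      _ = ENNReal.ofReal (d * ∫ z, g₂ z ∂μ) := by rw [integral_const_mul]
  have hI1 : ∫ x, g₁ x ∂μ ≤ 3 * T ^ 2 / 2 := by
    simp only [hg₁]
    rw [integral_div]
    exact div_le_div_of_nonneg_right (hmom4 i₀).2 (by norm_num)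
  have hI2 : ∫ z, g₂ z ∂μ ≤ 32 * (1 + 3 * T ^ 2 + 3 * T ^ 2) := by
    have hb : Integrable (fun z : PhaseSpace N => 32 * (1 + (z.2 k) ^ 4 + (z.2 k1) ^ 4)) μ :=
      (((integrable_const 1).add (hmom4 k).1).add (hmom4 k1).1).const_mul 32
    calc ∫ z, g₂ z ∂μ ≤ ∫ z, 32 * (1 + (z.2 k) ^ 4 + (z.2 k1) ^ 4) ∂μ := by
          refine integral_mono hg₂int hb fun z => ?_
          simp only [hg₂]
          have := one_add_abs_add_abs_pow_four_le (z.2 k) (z.2 k1)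
          linarith
      _ = 32 * (1 + ∫ z, (z.2 k) ^ 4 ∂μ + ∫ z, (z.2 k1) ^ 4 ∂μ) := by
          have hi1 : Integrable (fun z : PhaseSpace N => (1 : ℝ) + (z.2 k) ^ 4) μ := (integrable_const 1).add (hmom4 k).1
          have e1 : ∫ z, (1 : ℝ) + (z.2 k) ^ 4 + (z.2 k1) ^ 4 ∂μ = ∫ z, (1 : ℝ) + (z.2 k) ^ 4 ∂μ + ∫ z, (z.2 k1) ^ 4 ∂μ :=
            integral_add hi1 (hmom4 k1).1
          have e2 : ∫ z, (1 : ℝ) + (z.2 k) ^ 4 ∂μ = ∫ _z, (1 : ℝ) ∂μ + ∫ z, (z.2 k) ^ 4 ∂μ :=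
            integral_add (integrable_const 1) (hmom4 k).1
          have e3 : ∫ _z, (1 : ℝ) ∂μ = 1 := by simp [Measure.real]
          rw [integral_const_mul, e1, e2, e3]
      _ ≤ 32 * (1 + 3 * T ^ 2 + 3 * T ^ 2) :=
          mul_le_mul_of_nonneg_left (add_le_add (add_le_add le_rfl (hmom4 k).2) (hmom4 k1).2) (by norm_num)
  show ∫⁻ q, (ENNReal.ofReal (d * g₁ q.1) + ENNReal.ofReal (d * g₂ (P.solMap N T T s q.1 (pairPath q.2)))) ∂π ≤ _
  calc ∫⁻ q, (ENNReal.ofReal (d * g₁ q.1) + ENNReal.ofReal (d * g₂ (P.solMap N T T s q.1 (pairPath q.2)))) ∂π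
      = ∫⁻ q, ENNReal.ofReal (d * g₁ q.1) ∂π +
        ∫⁻ q, ENNReal.ofReal (d * g₂ (P.solMap N T T s q.1 (pairPath q.2))) ∂π :=
        lintegral_add_left (ENNReal.measurable_ofReal.comp (measurable_const.mul (hg₁m.comp measurable_fst))) _
    _ = ENNReal.ofReal (d * ∫ x, g₁ x ∂μ) + ENNReal.ofReal (d * ∫ z, g₂ z ∂μ) := by rw [hA1, hA2]
    _ ≤ ENNReal.ofReal (d * (3 * T ^ 2 / 2)) + ENNReal.ofReal (d * (32 * (1 + 3 * T ^ 2 + 3 * T ^ 2))) :=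
        add_le_add (ENNReal.ofReal_le_ofReal (mul_le_mul_of_nonneg_left hI1 hd0))
          (ENNReal.ofReal_le_ofReal (mul_le_mul_of_nonneg_left hI2 hd0))
    _ = ENNReal.ofReal (d * (3 * T ^ 2 / 2) + d * (32 * (1 + 3 * T ^ 2 + 3 * T ^ 2))) :=
        (ENNReal.ofReal_add (mul_nonneg hd0 (by positivity)) (mul_nonneg hd0 (by positivity))).symm
    _ ≤ ENNReal.ofReal (d * (195 * T ^ 2 + 32)) := by
        refine ENNReal.ofReal_le_ofReal ?_
        have hT' : 3 * T ^ 2 / 2 + 32 * (1 + 3 * T ^ 2 + 3 * T ^ 2) ≤ 195 * T ^ 2 + 32 := by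
          nlinarith [sq_nonneg T]
        calc d * (3 * T ^ 2 / 2) + d * (32 * (1 + 3 * T ^ 2 + 3 * T ^ 2))
            = d * (3 * T ^ 2 / 2 + 32 * (1 + 3 * T ^ 2 + 3 * T ^ 2)) := by ring
          _ ≤ d * (195 * T ^ 2 + 32) := mul_le_mul_of_nonneg_left hT' hd0

include hω hl hβ hγ hT in
/-- Fourth moment of the far current along the flow, from the Gibbs start and from the flipped Gibbs start: both equal
`∫ j_k⁴ dμ_T ≤ C₄` (stationarity on the Wiener space; flip invariance of `μ_T`). -/
theorem lintegral_current_four_le (hN : 0 < N) (i₀ k : Fin N) {C₄ : ℝ}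
    (hD2 : Integrable (fun x => (pinnedChain ω₂ lam β γ).bondCurrent N k x ^ 4)
        ((pinnedChain ω₂ lam β γ).gibbsMeasure N T) ∧
      ∫ x, (pinnedChain ω₂ lam β γ).bondCurrent N k x ^ 4 ∂((pinnedChain ω₂ lam β γ).gibbsMeasure N T) ≤ C₄)
    (s : ℝ≥0) :
    ∫⁻ q, ENNReal.ofReal ((pinnedChain ω₂ lam β γ).bondCurrent N k
        ((pinnedChain ω₂ lam β γ).solMap N T T s q.1 (pairPath q.2)) ^ 2) ^ 2
        ∂(((pinnedChain ω₂ lam β γ).gibbsMeasure N T).prod wienerPair) ≤ ENNReal.ofReal C₄ ∧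
    ∫⁻ q, ENNReal.ofReal ((pinnedChain ω₂ lam β γ).bondCurrent N k
        ((pinnedChain ω₂ lam β γ).solMap N T T s (momentumFlip i₀ q.1) (pairPath q.2)) ^ 2) ^ 2
        ∂(((pinnedChain ω₂ lam β γ).gibbsMeasure N T).prod wienerPair) ≤ ENNReal.ofReal C₄ := by
  set P := pinnedChain ω₂ lam β γ with hP
  set μ := P.gibbsMeasure N T with hμ
  set π : Measure (PhaseSpace N × WienerPair) := μ.prod wienerPair with hπ
  have hzm : Measurable fun q : PhaseSpace N × WienerPair => P.solMap N T T s q.1 (pairPath q.2) :=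
    pinnedChain_measurable_solMap_pairPath hω hl.le hβ.le hγ.le N T T s
  set Θ : PhaseSpace N × WienerPair → PhaseSpace N × WienerPair := fun q => (momentumFlip i₀ q.1, q.2) with hΘ
  have hΘm : Measurable Θ := ((measurable_momentumFlip i₀).comp measurable_fst).prodMk measurable_snd
  have hz'm : Measurable fun q : PhaseSpace N × WienerPair =>
      P.solMap N T T s (momentumFlip i₀ q.1) (pairPath q.2) := by
    have h := hzm.comp hΘm
    exact h
  have hjm : Measurable (P.bondCurrent N k) := (pinnedChain_continuous_bondCurrent ω₂ lam β γ N k).measurable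
  have hJm : Measurable fun q : PhaseSpace N × WienerPair => P.bondCurrent N k (P.solMap N T T s q.1 (pairPath q.2)) := by
    have h := hjm.comp hzm
    exact h
  have hJ'm : Measurable fun q : PhaseSpace N × WienerPair =>
      P.bondCurrent N k (P.solMap N T T s (momentumFlip i₀ q.1) (pairPath q.2)) := by
    have h := hjm.comp hz'm
    exact h
  have hiter : ∀ {G : PhaseSpace N × WienerPair → ℝ≥0∞}, Measurable G →
      ∫⁻ x, ∫⁻ ω, G (x, ω) ∂wienerPair ∂μ = ∫⁻ q, G q ∂π := by
    intro G hG
    exact (lintegral_prod G hG.aemeasurable).symm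
  have e4 : ∀ r : ℝ, ENNReal.ofReal (r ^ 2) ^ 2 = ENNReal.ofReal (r ^ 4) := by
    intro r; rw [← ENNReal.ofReal_pow (sq_nonneg _)]; ring_nf
  have hstat := lintegral_lintegral_solMap_gibbs hω hl.le hβ.le hγ.le hN hT
    (g := fun z => ENNReal.ofReal (P.bondCurrent N k z ^ 4)) (ENNReal.measurable_ofReal.comp (hjm.pow_const 4)) s
  have hval : ∫⁻ z, ENNReal.ofReal (P.bondCurrent N k z ^ 4) ∂μ ≤ ENNReal.ofReal C₄ := by
    rw [← ofReal_integral_eq_lintegral_ofReal hD2.1 (ae_of_all _ fun z => by positivity)]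
    exact ENNReal.ofReal_le_ofReal hD2.2
  constructor
  · simp_rw [e4]
    rw [← hiter (G := fun q => ENNReal.ofReal (P.bondCurrent N k (P.solMap N T T s q.1 (pairPath q.2)) ^ 4))
      (ENNReal.measurable_ofReal.comp (hJm.pow_const 4)), hstat]
    exact hval
  · simp_rw [e4]
    rw [← hiter (G := fun q => ENNReal.ofReal (P.bondCurrent N k (P.solMap N T T s (momentumFlip i₀ q.1) (pairPath q.2)) ^ 4))
      (ENNReal.measurable_ofReal.comp (hJ'm.pow_const 4))]
    have hGm : Measurable fun y : PhaseSpace N =>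
        ∫⁻ ω, ENNReal.ofReal (P.bondCurrent N k (P.solMap N T T s y (pairPath ω)) ^ 4) ∂wienerPair := by
      have h := (ENNReal.measurable_ofReal.comp (hJm.pow_const 4)).lintegral_prod_right' (ν := wienerPair)
      exact h
    rw [lintegral_comp_momentumFlip_gibbs P N T i₀ hGm, hstat]
    exact hval

end FSAssembly

end Summit.AtomisticToContinuum.FouriersLaw.Theorems.NonBallistic

end
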